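import Mathlib.Analysis.InnerProductSpace.PiL2
import Mathlib.Analysis.SpecialFunctions.Pow.Deriv
import Mathlib.Analysis.Calculus.FDeriv.Comp
import HarnessLib

/-!
# The Euler identity of a function homogeneous along one ray

Stub E1 of line `Sketch` (skeleton v24) for crux `MoebiusLimitExists` (stmt-CriticalPhenomena-1344):
if `F : (ℝ³)ⁿ → ℝ` satisfies `F (t • x) = tᵃ F x` for all `t > 0` (homogeneity along the ray through the single
configuration `x` only) and `F` is differentiable at `x`, then `DF(x)[x] = a F(x)`.
Proof: differentiate `t ↦ F (t • x) = tᵃ F x` at `t = 1` (chain rule along the curve `t ↦ t • x`, derivative of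
`Real.rpow`, the two sides agree on the neighbourhood `Set.Ioi 0` of `1`, uniqueness of derivatives).
One-point variant of `MoebiusLimitExistsDefectSymmetry.fderiv_self_of_scaleCovariant`.

Reference: Di Francesco–Mathieu–Sénéchal 1997 §4.1 (4.18)–(4.19) [FrancescoMathieuSenechal1997].
-/

namespace Summit.CriticalPhenomena.Ising3DConformalLimit.MoebiusLimitExistsSketchV24

open Filter Topology Set

/-- **The Euler identity at one point.**  If `F (t • x) = t ^ a * F x` for all `t > 0` (along the ray through `x`
only) and `F` is differentiable at `x`, then `DF(x)[x] = a F(x)` (differentiate `t ↦ F (t • x) = tᵃ F x` at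
`t = 1`). [cite: FrancescoMathieuSenechal1997, §4.1 (4.18)–(4.19)] -/
theorem stub_fderiv_self_of_homogeneous_at : ∀ (n : ℕ) (F : (Fin n → EuclideanSpace ℝ (Fin 3)) → ℝ) (a : ℝ)
    (x : Fin n → EuclideanSpace ℝ (Fin 3)),
    DifferentiableAt ℝ F x → (∀ t : ℝ, 0 < t → F (t • x) = t ^ a * F x) → fderiv ℝ F x x = a * F x := by
  -- adapted from `MoebiusLimitExistsDefectSymmetry.fderiv_self_of_scaleCovariant` (the proof there only uses the ray through `x`)
  intro n F a x hF hhom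
  -- the curve `t ↦ t • x` through `x` at `t = 1`
  have hγ : HasDerivAt (fun t : ℝ => t • x) x 1 := by
    simpa using (hasDerivAt_id (1 : ℝ)).smul_const x
  have h1 : HasDerivAt (fun t : ℝ => F (t • x)) (fderiv ℝ F x x) 1 :=
    hF.hasFDerivAt.comp_hasDerivAt_of_eq 1 hγ (one_smul ℝ x).symm
  -- along the curve `F` is the power function `t ↦ t ^ a * F x`
  have h2 : HasDerivAt (fun t : ℝ => t ^ a * F x) (a * F x) 1 := by
    have h := (Real.hasDerivAt_rpow_const (x := (1 : ℝ)) (p := a) (Or.inl one_ne_zero)).mul_const (F x)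
    simpa using h
  have heq : (fun t : ℝ => F (t • x)) =ᶠ[𝓝 1] fun t => t ^ a * F x := by
    filter_upwards [Ioi_mem_nhds (zero_lt_one' ℝ)] with t ht
    exact hhom t ht
  exact h1.unique (h2.congr_of_eventuallyEq heq)

end Summit.CriticalPhenomena.Ising3DConformalLimit.MoebiusLimitExistsSketchV24
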